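import Literature.Geometry.Lorentzian.KillingFieldAnalyticExtension
import Literature.Geometry.Lorentzian.NomizuKillingExtensionProofs
import HarnessLib

/-!
# Proof of Nomizu's extension theorem, `C^ω` form (`Nomizu1960KillingExtension`)

Discharge (`Nomizu1960KillingExtension_holds`) of the named fact `Nomizu1960KillingExtension` of
the sibling file `KillingFieldAnalyticExtension.lean`: K. Nomizu, *On local and global existence of
Killing vector fields*, Ann. of Math. (2) 72 (1960) 105–120, Theorems 1–2, in the
pseudo-Riemannian form printed as Theorem 2.1 of P. T. Chruściel, *On rigidity of analytic black
holes*, Commun. Math. Phys. 189 (1997) 1–7 (arXiv:gr-qc/9610011, §2, p. 5 of the arXiv version,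
with the footnote "all the assertions and proofs of [Nomizu] remain valid word for word when
'Riemannian' is replaced by 'pseudo-Riemannian'"): on a simply connected real-analytic
pseudo-Riemannian manifold a Killing field given on a connected open subset extends to a global
Killing field.

That fact renders "Killing field" by the tree's notions `g.IsKillingFieldOn` / `g.IsKillingField`
at the metric's regularity `ω` (the fields are `C^ω`), over arbitrary universes and under
`[I.Boundaryless]`; the sibling fact `PseudoRiemannianMetric.Nomizu1960_killing_extension`
(`NomizuKillingExtension.lean`, discharged in `NomizuKillingExtensionProofs.lean`) asks only `C^∞`
fields. The proof here re-runs the (universe-polymorphic) analytic-continuation argument of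
`NomizuKillingExtensionProofs.lean` — unique continuation `killing_eqOn_of_eventuallyEq`, Nomizu's
Theorem 1 on chart balls `exists_killing_extension_nhds`, and the monodromy theorem for sheaves of
functions `Literature.Topology.CoveringSpaces.exists_extension_of_simplyConnected` — and adds the
one missing step, the classical regularity statement that **a Killing field of a real-analytic
metric is real-analytic** (`contMDiffAt_omega_of_killingOn`): read in an extended chart, a `C^∞`
Killing field is a `C²` solution of the coordinate Killing equation of the analytic chart metric,
hence (Nomizu's Theorem 1 in the chart, `KillingAnalyticChart.exists_extension_of_mem_ball`, whose
output is analytic and agrees with the given solution near the centre) coincides near the point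
with an analytic coordinate field, and the pull-back of an analytic coordinate field along the
analytic extended chart is an analytic section of `TM`.

Everything is proved; no definitions, no named facts (D-0026).

## References

* K. Nomizu, Ann. of Math. (2) 72 (1960) 105–120, Theorems 1–2 (and §1: Killing fields of an
  analytic metric are analytic). [Nomizu1960]
* P. T. Chruściel, Commun. Math. Phys. 189 (1997) 1–7, Thm. 2.1 and footnote
  (arXiv:gr-qc/9610011). [Chrusciel1997]
* S. Kobayashi, K. Nomizu, *Foundations of Differential Geometry* I (1963), Ch. VI §6, Thm. 6.1,
  Lemmas 1–4; Appendix 7. [KobayashiNomizu1963]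
* B. O'Neill, *Semi-Riemannian geometry* (1983), Ch. 9, Def. 9.22, Prop. 9.25, Lemma 9.28.
  [ONeillSemiRiemannian1983]
-/

noncomputable section

open Bundle Set Function Filter TopologicalSpace VectorField Metric
open Literature.Geometry.Manifold (ExtRechart)
open scoped Manifold ContDiff Topology

namespace Literature.Geometry.Lorentzian

universe u v w

namespace PseudoRiemannianMetric

section LocPathConnected

/-- A charted space over a real model with corners is locally path connected (`range I` is
convex; private copy of the tree's `locallyPathConnectedSpace_of_modelWithCorners`,
`Literature/Topology/FourManifolds/SmoothOrientationProofs.lean`, to keep the four-manifold files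
out of the import cone). [folklore] -/
private theorem locallyPathConnectedSpace_of_model' {E : Type u} [NormedAddCommGroup E]
    [NormedSpace ℝ E] {H : Type v} [TopologicalSpace H] (I : ModelWithCorners ℝ E H)
    (M : Type w) [TopologicalSpace M] [ChartedSpace H M] : LocallyPathConnectedSpace M := by
  have : LocallyPathConnectedSpace (range I) := I.convex_range.locallyPathConnectedSpace
  have : LocallyPathConnectedSpace H :=
    I.isClosedEmbedding.isEmbedding.toHomeomorph.isOpenEmbedding.locallyPathConnectedSpace
  exact ChartedSpace.locallyPathConnectedSpace H M

end LocPathConnected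

section Analytic

variable {E : Type u} [NormedAddCommGroup E] [NormedSpace ℝ E] [FiniteDimensional ℝ E]
  {H : Type v} [TopologicalSpace H] {I : ModelWithCorners ℝ E H}
  {M : Type w} [TopologicalSpace M] [ChartedSpace H M] [IsManifold I ω M] [BoundarylessManifold I M]
  (g : PseudoRiemannianMetric I ω E (TangentSpace I : M → Type _)) [g.HasLeviCivita]

/-! ### Analytic coordinate fields pull back to analytic sections -/

omit [BoundarylessManifold I M] in
/-- The pull-back `φ^* X` along the extended chart `φ` at `x₀` of a coordinate field `X : E → E`
which is real-analytic on a set `V ⊆ E` is a real-analytic section of `TM` on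
`φ.source ∩ φ ⁻¹' V` (Mathlib's `ContMDiffWithinAt.mpullback_vectorField_preimage` at regularity
`ω`: the chart is analytic with invertible differential on its source). [folklore] -/
theorem contMDiffOn_omega_mpullback_extChartAt (x₀ : M) {X : E → E} {V : Set E}
    (hXs : ContDiffOn ℝ ω X V) :
    ContMDiffOn I I.tangent ω
      (fun y ↦ (TotalSpace.mk' E y (mpullback I 𝓘(ℝ, E) (extChartAt I x₀)
        (fun z : E ↦ (X z : TangentSpace 𝓘(ℝ, E) z)) y) : TangentBundle I M))
      ((extChartAt I x₀).source ∩ extChartAt I x₀ ⁻¹' V) := by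
  rintro y ⟨hy, hyV⟩
  have hXsec : ContMDiffWithinAt 𝓘(ℝ, E) (𝓘(ℝ, E).prod 𝓘(ℝ, E)) ω
      (fun z : E ↦ (TotalSpace.mk' E z (X z) : TangentBundle 𝓘(ℝ, E) E)) V (extChartAt I x₀ y) :=
    contMDiffWithinAt_vectorSpace_iff_contDiffWithinAt.2 (hXs _ hyV)
  have hext : ContMDiffAt I 𝓘(ℝ, E) ω (extChartAt I x₀) y :=
    ExtChartKilling.contMDiffAt_extChartAt_of_mem hy
  have hinv : (mfderiv I 𝓘(ℝ, E) (extChartAt I x₀) y).IsInvertible :=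
    isInvertible_mfderiv_extChartAt hy
  exact (ContMDiffWithinAt.mpullback_vectorField_preimage hXsec hext hinv le_top).mono
    inter_subset_right

/-! ### Killing fields of analytic metrics are analytic -/

/-- **Killing fields of a real-analytic metric are real-analytic.** A field `f`, `C^∞` and
Killing for the `C^ω` metric `g` on an open set `U`, is `C^ω` (as a section of `TM`) at every point
`x₀ ∈ U`. Proof: read in the extended chart at `x₀`, `f` is a `C²` solution `X` of the coordinate
Killing equation of the analytic chart metric on a chart ball around `φ x₀`
(`exists_coord_solution`); Nomizu's analytic extension on the ball
(`KillingAnalyticChart.exists_extension_of_mem_ball`) is an analytic coordinate field `X'` equal to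
`X` on that ball, so that near `x₀` the field `f = φ^* X = φ^* X'` is the analytic pull-back of an
analytic coordinate field (`contMDiffOn_omega_mpullback_extChartAt`). Nomizu 1960, §1 (Killing
fields of analytic Riemannian metrics are analytic, being solutions of the elliptic/prolonged
Killing system with analytic coefficients); Kobayashi–Nomizu I, Ch. VI, Thm. 6.1 ff.
[cite: Nomizu1960, §1 and Theorem 1] -/
theorem contMDiffAt_omega_of_killingOn {U : Set M} (hU : IsOpen U)
    {f : Π x : M, TangentSpace I x}
    (hfs : ContMDiffOn I I.tangent ∞ (fun x ↦ (TotalSpace.mk' E x (f x) : TangentBundle I M)) U)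
    (hfK : ∀ x ∈ U, ∀ v w : TangentSpace I x,
      g.val x (g.leviCivita f x v) w + g.val x v (g.leviCivita f x w) = 0)
    {x₀ : M} (hx₀ : x₀ ∈ U) :
    ContMDiffAt I I.tangent ω (fun x ↦ (TotalSpace.mk' E x (f x) : TangentBundle I M)) x₀ := by
  obtain ⟨G, r, hr, hrt, hG, hGa, hGs, hGn⟩ := exists_chart_ball g x₀
  -- a chart ball around `φ x₀` over `U`, of radius at most `r / 2`
  have hSo : IsOpen ((extChartAt I x₀).target ∩ (extChartAt I x₀).symm ⁻¹' U) :=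
    (contMDiffOn_extChartAt_symm (n := ω) x₀).continuousOn.isOpen_inter_preimage
      (ExtRechart.isOpen_extChartAt_target x₀) hU
  have hcS : extChartAt I x₀ x₀ ∈ (extChartAt I x₀).target ∩ (extChartAt I x₀).symm ⁻¹' U :=
    ⟨mem_extChartAt_target x₀, by rw [mem_preimage, extChartAt_to_inv]; exact hx₀⟩
  obtain ⟨r₁, hr₁, hr₁S⟩ := Metric.isOpen_iff.mp hSo _ hcS
  have hρ : 0 < min (r / 2) r₁ := lt_min (half_pos hr) hr₁
  have hρr : min (r / 2) r₁ ≤ r / 2 := min_le_left _ _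
  have hρt : ball (extChartAt I x₀ x₀) (min (r / 2) r₁) ⊆ (extChartAt I x₀).target :=
    fun z hz ↦ (hr₁S (ball_subset_ball (min_le_right _ _) hz)).1
  have hρU : ∀ z ∈ ball (extChartAt I x₀ x₀) (min (r / 2) r₁), (extChartAt I x₀).symm z ∈ U :=
    fun z hz ↦ (hr₁S (ball_subset_ball (min_le_right _ _) hz)).2
  -- `f` read in the chart: a `C²` coordinate Killing solution `X` on the ball
  obtain ⟨X, hX, hXs, hXK⟩ := exists_coord_solution g hG hU hfs hfK hρt hρU
  -- Nomizu's analytic extension `X'` of `X` over the chart ball `B_r(φ x₀)`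
  have hqc : extChartAt I x₀ x₀ ∈ ball (extChartAt I x₀ x₀) (r / 2) := mem_ball_self (half_pos hr)
  obtain ⟨X', hX'a, -, hX'eq⟩ :=
    KillingAnalyticChart.exists_extension_of_mem_ball hGa hGs hGn hqc hρ hρr hXs hXK
  -- `φ^* X'` is analytic on `φ.source ∩ φ ⁻¹' B_r(φ x₀) ∋ x₀`
  have hWo : IsOpen ((extChartAt I x₀).source ∩ extChartAt I x₀ ⁻¹' ball (extChartAt I x₀ x₀) r) :=
    isOpen_extChartAt_preimage' x₀ isOpen_ball
  have hx₀W : x₀ ∈ (extChartAt I x₀).source ∩ extChartAt I x₀ ⁻¹' ball (extChartAt I x₀ x₀) r :=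
    ⟨mem_extChartAt_source x₀, mem_ball_self hr⟩
  have hF : ContMDiffAt I I.tangent ω
      (fun y ↦ (TotalSpace.mk' E y (mpullback I 𝓘(ℝ, E) (extChartAt I x₀)
        (fun z : E ↦ (X' z : TangentSpace 𝓘(ℝ, E) z)) y) : TangentBundle I M)) x₀ :=
    (contMDiffOn_omega_mpullback_extChartAt x₀ hX'a _ hx₀W).contMDiffAt (hWo.mem_nhds hx₀W)
  -- and `f = φ^* X = φ^* X'` near `x₀`
  have hVo : IsOpen ((extChartAt I x₀).source ∩ extChartAt I x₀ ⁻¹' ball (extChartAt I x₀ x₀)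
      (min (r / 2) r₁)) :=
    isOpen_extChartAt_preimage' x₀ isOpen_ball
  have hx₀V : x₀ ∈ (extChartAt I x₀).source ∩ extChartAt I x₀ ⁻¹' ball (extChartAt I x₀ x₀)
      (min (r / 2) r₁) :=
    ⟨mem_extChartAt_source x₀, mem_ball_self hρ⟩
  refine hF.congr_of_eventuallyEq (Filter.eventuallyEq_of_mem (hVo.mem_nhds hx₀V) ?_)
  rintro y ⟨hys, hyb⟩
  obtain ⟨p, rfl⟩ := ExtChartKilling.exists_symm_eq x₀ hys
  have hpb : (p : E) ∈ ball (extChartAt I x₀ x₀) (min (r / 2) r₁) := by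
    rwa [mem_preimage, ExtChartKilling.apply_symm] at hyb
  have hval : f ((extChartAt I x₀).symm p) = mpullback I 𝓘(ℝ, E) (extChartAt I x₀)
      (fun z : E ↦ (X' z : TangentSpace 𝓘(ℝ, E) z)) ((extChartAt I x₀).symm p) := by
    rw [← ExtChartKilling.mpullback_extChartAt_repr_apply hX p, mpullback_apply, mpullback_apply]
    refine congrArg _ ?_
    show X (extChartAt I x₀ ((extChartAt I x₀).symm p)) =
      X' (extChartAt I x₀ ((extChartAt I x₀).symm p))
    rw [ExtChartKilling.apply_symm]
    exact (hX'eq hpb).symm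
  show (TotalSpace.mk' E ((extChartAt I x₀).symm p) (f ((extChartAt I x₀).symm p)) :
      TangentBundle I M) = _
  rw [hval]

/-- **A `C^∞` Killing field of an analytic metric is a Killing field in the tree's `C^ω` sense.**
For the `C^ω` metric `g`, a field `C^∞` on `M` satisfying the Killing equation everywhere is a
Killing field of `g` (`g.IsKillingField`, which records `C^ω` regularity):
`contMDiffAt_omega_of_killingOn` on `U = M`. Nomizu 1960, §1. [cite: Nomizu1960, §1] -/
theorem isKillingField_of_contMDiff_infty {F : Π x : M, TangentSpace I x}
    (hFs : ContMDiff I I.tangent ∞ (fun x ↦ (TotalSpace.mk' E x (F x) : TangentBundle I M)))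
    (hFK : ∀ (x : M) (v w : TangentSpace I x),
      g.val x (g.leviCivita F x v) w + g.val x v (g.leviCivita F x w) = 0) :
    g.IsKillingField F :=
  ⟨fun x ↦ contMDiffAt_omega_of_killingOn g isOpen_univ hFs.contMDiffOn
    (fun x _ v w ↦ hFK x v w) (mem_univ x), hFK⟩

/-! ### Nomizu's theorem with analytic conclusion, over arbitrary universes -/

/-- **Nomizu's extension theorem, `C^ω` conclusion (Nomizu 1960, Thms. 1–2; Chruściel 1997,
Thm. 2.1).** On a simply connected real-analytic manifold without boundary carrying a `C^ω`
pseudo-Riemannian metric `g` (any signature), a field `Y`, `C^∞` and Killing on a connected open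
set `O`, extends to a global Killing field of `g` in the tree's sense (`g.IsKillingField`: `C^ω`
on `M` and Killing at every point) agreeing with `Y` on `O`. Proof: the sheaf of local `C^∞`
Killing fields has unique continuation (`killing_eqOn_of_eventuallyEq`) and Nomizu's local
extension property (`exists_killing_extension_nhds`), so the monodromy theorem
(`Literature.Topology.CoveringSpaces.exists_extension_of_simplyConnected`) extends `Y` to a global
`C^∞` Killing field, which is analytic by `isKillingField_of_contMDiff_infty`. (Same argument as
`Nomizu1960_killing_extension_holds`, run universe-polymorphically.)
[cite: Nomizu1960, Theorems 1–2] [cite: Chrusciel1997, Thm. 2.1 (Nomizu)] -/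
theorem exists_isKillingField_extension_of_simplyConnected [SimplyConnectedSpace M]
    {O : Set M} (hO : IsOpen O) (hOc : IsConnected O) {Y : Π x : M, TangentSpace I x}
    (hYs : ContMDiffOn I I.tangent ∞ (fun x ↦ (TotalSpace.mk' E x (Y x) : TangentBundle I M)) O)
    (hYK : ∀ x ∈ O, ∀ v w : TangentSpace I x,
      g.val x (g.leviCivita Y x v) w + g.val x v (g.leviCivita Y x w) = 0) :
    ∃ Yhat : Π x : M, TangentSpace I x, g.IsKillingField Yhat ∧ ∀ x ∈ O, Yhat x = Y x := by
  haveI : LocallyPathConnectedSpace M := locallyPathConnectedSpace_of_model' I M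
  obtain ⟨F, hF, hFeq⟩ :=
    Literature.Topology.CoveringSpaces.exists_extension_of_simplyConnected (M := M) (V := E)
      (fun U f ↦ IsOpen U ∧
        ContMDiffOn I I.tangent ∞ (fun x ↦ (TotalSpace.mk' E x (f x) : TangentBundle I M)) U ∧
        ∀ x ∈ U, ∀ v w : TangentSpace I x,
          g.val x (g.leviCivita f x v) w + g.val x v (g.leviCivita f x w) = 0)
      (fun U U' f hf hU' hsub ↦ ⟨hU', hf.2.1.mono hsub, fun x hx ↦ hf.2.2 x (hsub hx)⟩)
      (fun U f f' hU hUc hf hf' x hx heq ↦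
        killing_eqOn_of_eventuallyEq g hU hUc hf.2.1 hf.2.2 hf'.2.1 hf'.2.2 hx heq)
      (fun x₀ ↦ by
        obtain ⟨W, hWo, hx₀, hWc, hext⟩ := exists_killing_extension_nhds g x₀
        refine ⟨W, hWo, hx₀, hWc, fun y hy U f hU hyU hf ↦ ?_⟩
        obtain ⟨f', h1, h2, h3⟩ := hext y hy U f hU hyU hf.2.1 hf.2.2
        exact ⟨f', ⟨hWo, h1, h2⟩, h3⟩)
      (fun F hF ↦ by
        obtain ⟨h1, h2⟩ := killing_of_locally g (F := F) fun x ↦ by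
          obtain ⟨U, hU, hx, f, hf, hFf⟩ := hF x
          exact ⟨U, hU, hx, f, hf.2.1, hf.2.2, hFf⟩
        exact ⟨isOpen_univ, h1.contMDiffOn, fun x _ v w ↦ h2 x v w⟩)
      hO hOc ⟨hO, hYs, hYK⟩
  exact ⟨F, isKillingField_of_contMDiff_infty g (contMDiffOn_univ.mp hF.2.1)
    (fun x v w ↦ hF.2.2 x (mem_univ x) v w), hFeq⟩

end Analytic

end PseudoRiemannianMetric

/-! ### Nomizu's theorem: the discharge -/

/-- **DISCHARGE of `Nomizu1960KillingExtension` (Nomizu 1960, Thms. 1–2; pseudo-Riemannian form: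
Chruściel 1997, Thm. 2.1): on a simply connected real-analytic pseudo-Riemannian manifold every
Killing field defined on a connected open subset extends to a global Killing field.** "Let `(M, g)`
be a (connected) simply connected analytic pseudo-Riemannian manifold, and suppose that there
exists a Killing vector field `Y` defined on an open connected subset `𝒪` of `M`. Then there
exists a Killing vector field `Ŷ` defined on `M` which coincides with `Y` on `𝒪`." A Killing field
on `O` in the tree's `C^ω` sense is in particular `C^∞` and Killing on `O`, and
`PseudoRiemannianMetric.exists_isKillingField_extension_of_simplyConnected` (the analytic
continuation of Nomizu, organised as in Kobayashi–Nomizu I, Ch. VI, Thm. 6.1, with the regularity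
statement that Killing fields of analytic metrics are analytic) produces the global `C^ω` Killing
extension; `[I.Boundaryless]` gives `BoundarylessManifold I M`.
[cite: Nomizu1960, Theorems 1–2] [cite: Chrusciel1997, Thm. 2.1 (with footnote)] -/
theorem Nomizu1960KillingExtension_holds : Nomizu1960KillingExtension := by
  intro E _ _ _ _ H _ I _ M _ _ _ _ _ _ g _ O hO hOc Y hY
  exact PseudoRiemannianMetric.exists_isKillingField_extension_of_simplyConnected g hO hOc
    (hY.contMDiffOn.of_le le_top) (fun x hx v w ↦ hY.val_leviCivita_add hx v w)

end Literature.Geometry.Lorentzian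

end
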